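import Summits.HodgeConjecture.HodgeConjecture.Theses.EndoscopicMiddleDegree
import Literature.AlgebraicGeometry.HodgeTheory.CompactBallQuotient

/-!
# Line `kottwitz-rigidity` for crux `SectorComplement` (stmt-HodgeConjecture-14353) — NO SKELETON (file `KottwitzRigidityNoGo.lean`, crux dir root; NOT under `Lines/`, which is reserved for registered skeletons)

crux-plan seat `planner-cruxplan-stmt-HodgeConjecture-14353-kottwitz-rigidity-0`, 2026-08-16.
Crux (route `EndoscopicMiddleDegree`, rev 9): `SectorComplement := MiddleDegreeStep → _root_.HodgeConjecture`
— the route's DECLARED, NOT-CLAIMED sector frame (kind support, auto-cruxed on the docstring words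
"open problem"). Idea: `Ideas/kottwitz-rigidity.md` (cell 𝒦 = compact unitary ball quotients of
division-algebra type; lever: no endoscopy ⟹ single Speh block ⟹ Tate-free non-Lefschetz pieces ⟹
every algebraic class on 𝒦 lies in `ℚ·Lᵏ`; HC(𝒦) ⟺ `LefschetzOnly` ⟺ "Hodge ⟹ absolute Hodge on 𝒦").

**Verdict: no-skeleton.** This file is NOT a skeleton — it registers no `stub_*` and contains no
`SectorComplement_of`. It is the kernel-checked NO-GO CERTIFICATE behind the verdict (sorry-free):

* §1 types the idea's entire positive content as far as the tree allows (over an ABSTRACT membership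
  predicate `K`, because no division-algebra datum `KottwitzBallQuotientDatum` (D1), no Hecke-isotypic
  decomposition (D2) and no étale realisation (D3) exist in the tree): `CellLefschetzOnly K → CellHC K`
  — the Hodge conjecture ON THE CELL, with no use of `MiddleDegreeStep`.
* §2 the frame gap: `SectorComplement ↔ (MiddleDegreeStep → CellHC K ∧ OffCellHC K)`; so the best
  honest composition from the idea is `CellLefschetzOnly K → (MiddleDegreeStep → OffCellHC K) →
  SectorComplement` (`sectorComplement_of_cell_and_offCell`, deliberately not named `_of`), and the
  residual `OffCellHC K` = "HC for every smooth projective variety outside the cell" cannot be dropped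
  (`offCellHC_of_sectorComplement`).
* §3 COSTUME CERTIFICATE: given the line's own cell stub and the crux hypothesis, the residual stub is
  EQUIVALENT to the crux (`offCellHC_iff_sectorComplement`) — the mechanical definition of costume;
  for every cell inside the compact-ball-quotient family (𝒦 is one) the residual contains the Hodge
  conjecture for EVERY smooth projective variety that is not a compact ball quotient
  (`offCellHC_nonBallQuotient`: abelian varieties, hypersurfaces, …); and for the only instance of 𝒦
  constructible today (the empty cell) the residual is the summit verbatim (`offCellHC_empty_iff`).
* §4 the one place the idea meets the crux BY NAME is negative: `CellAlgebraicRankLeOne K` (the card's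
  unconditional-on-paper consequence of Tate-freeness: `Algᵏ ⊆ ℂ·ℓ_k`) plus two independent rational
  Hodge classes in one degree on one member of the cell refute `HodgeConjecture`, hence
  `MiddleDegreeStep → ¬ SectorComplement` (`not_sectorComplement_of_exotic`) — the disprover's
  `¬SectorComplement ↔ MiddleDegreeStep ∧ ¬HC` made concrete; handed to the cdisprove seat.
* §5 the card's residual-degree numerology `S_p` as a decidable function with its instances checked by
  `decide` (p = 5 ↦ degrees {4, 6}; p + 1 ∈ {8, 16} ↦ no even residual degree; p + 1 = 9 ↦ {6, 8, 10};
  p + 1 = 11 ↦ only the middle) — the typed shape of the harvestable THEOREM-CANDIDATE (off `S_p`,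
  `H^{k,k} = ℂ·Lᵏ` on 𝒦: Clozel 1993 + Vogan–Zuckerman/Adams–Johnson), for a Literature fact request.

Disproof.lean used: `sectorComplement_iff_of_middleDegreeStep`, `hodgeConjecture_iff`,
`not_sectorComplement_iff` (re-derived in §0 so that this file does not depend on the workfile build);
no `_false_without_` lemma exists for this crux; no `Negative/` lemma has landed (nothing to import).
-/

set_option linter.dupNamespace false

namespace Summit.HodgeConjecture.HodgeConjecture.Cruxes.SectorComplement.KottwitzRigidity

open Literature.AlgebraicGeometry.Motives (SchemeOver IsSmoothProjective)
open Literature.AlgebraicGeometry.HodgeTheory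
open Literature.AlgebraicGeometry.ShimuraVarieties (UnitaryBallQuotientDatum)
open Summit.HodgeConjecture.HodgeConjecture.Theses.EndoscopicMiddleDegree
  (MiddleDegreeStep SectorComplement)

/-! ## §0 Frame reductions (= Disproof.lean `sectorComplement_iff_of_middleDegreeStep`,
`not_sectorComplement_iff`, re-derived; `HC → MiddleDegreeStep` is Disproof's
`middleDegreeStep_of_hodgeConjecture` and is not repeated here) -/

/-- Given the route target, the frame IS the summit. [folklore] -/
theorem sectorComplement_iff_hodgeConjecture (hM : MiddleDegreeStep) :
    SectorComplement ↔ _root_.HodgeConjecture :=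
  ⟨fun h ↦ h hM, fun h _ ↦ h⟩

/-- The exact content of a refutation of the crux. [folklore] -/
theorem not_sectorComplement_iff :
    ¬ SectorComplement ↔ MiddleDegreeStep ∧ ¬ _root_.HodgeConjecture := by
  constructor
  · intro h
    by_contra h'
    exact h fun hM ↦ Classical.by_contradiction fun hHC ↦ h' ⟨hM, hHC⟩
  · rintro ⟨hM, hHC⟩ hS
    exact hHC (hS hM)

/-! ## §1 The cell shell: the idea's typable positive content -/

/-- Rational Hodge `(k,k)`-classes in `H^{2k}(X(ℂ); ℂ)` of the `n`-dimensional `X`. -/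
def hdgQ (n : ℕ) (X : SchemeOver ℂ) (k : ℕ) : Set (complexBetti X (2 * k)) :=
  {c | IsRationalClass c ∧ IsOfHodgeType n X (2 * k) k k c}

/-- `LefschetzOnly`: in every degree `2k` all rational Hodge classes are multiples of ONE algebraic
class `ℓ_k` (intended `ℓ_k = Lᵏ`, `L = c₁(K_X)`). On 𝒦 this is EQUIVALENT to HC (card §Transfer). -/
def LefschetzOnly (n : ℕ) (X : SchemeOver ℂ) : Prop :=
  ∀ k, ∃ ℓ ∈ algebraicClasses X k, ∀ c ∈ hdgQ n X k, ∃ t : ℂ, c = t • ℓ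

variable (K : ℕ → SchemeOver ℂ → Prop)

/-- The Hodge conjecture ON the cell `K`. -/
def CellHC : Prop :=
  ∀ ⦃n : ℕ⦄ ⦃X : SchemeOver ℂ⦄, IsSmoothProjective n X → K n X → HodgeConjectureFor n X

/-- The Hodge conjecture OFF the cell `K` — the residual any concluding skeleton must carry. -/
def OffCellHC : Prop :=
  ∀ ⦃n : ℕ⦄ ⦃X : SchemeOver ℂ⦄, IsSmoothProjective n X → ¬ K n X → HodgeConjectureFor n X

/-- STUB SHAPE of the line's two conjuncts composed (`TateFreeSpehPieces ∧ KottwitzHodgeAbsolute`: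
absolute Hodge ⟹ potentially Tate ⟹ `ℚ·Lᵏ`; the étale side is untypable, so only the OUTPUT shape
types): every member of the cell has a Hodge model and is `LefschetzOnly`. -/
def CellLefschetzOnly : Prop :=
  ∀ ⦃n : ℕ⦄ ⦃X : SchemeOver ℂ⦄, IsSmoothProjective n X → K n X →
    Nonempty (HodgeModel n X) ∧ LefschetzOnly n X

variable {K}

/-- `LefschetzOnly` varieties with a Hodge model satisfy the Hodge conjecture (no cycle beyond `ℓ_k`). -/
theorem hodgeConjectureFor_of_lefschetzOnly {n : ℕ} {X : SchemeOver ℂ} (hA : Nonempty (HodgeModel n X))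
    (hL : LefschetzOnly n X) : HodgeConjectureFor n X := by
  refine ⟨hA, fun k c hc hH ↦ ?_⟩
  obtain ⟨ℓ, hℓ, h⟩ := hL k
  obtain ⟨t, rfl⟩ := h c ⟨hc, hH⟩
  exact Submodule.smul_mem _ t hℓ

/-- The idea's whole positive content, typed: the cell stubs give HC ON THE CELL — and nothing about
the crux; note that `MiddleDegreeStep` is not consumed. -/
theorem cellHC_of_cellLefschetzOnly (h : CellLefschetzOnly K) : CellHC K :=
  fun _ _ hX hK ↦ hodgeConjectureFor_of_lefschetzOnly (h hX hK).1 (h hX hK).2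

/-! ## §2 The frame gap -/

variable (K)

/-- The summit splits along any cell. [folklore] -/
theorem hodgeConjecture_iff_cell_and_offCell : _root_.HodgeConjecture ↔ CellHC K ∧ OffCellHC K := by
  constructor
  · exact fun h ↦ ⟨fun n X hX _ ↦ h hX, fun n X hX _ ↦ h hX⟩
  · rintro ⟨h₁, h₂⟩ n X hX
    by_cases hK : K n X
    · exact h₁ hX hK
    · exact h₂ hX hK

/-- The crux splits accordingly: what a concluding skeleton built on the cell must supply. -/
theorem sectorComplement_iff_cell_and_offCell :
    SectorComplement ↔ (MiddleDegreeStep → CellHC K ∧ OffCellHC K) :=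
  ⟨fun h hM ↦ (hodgeConjecture_iff_cell_and_offCell K).1 (h hM),
    fun h hM ↦ (hodgeConjecture_iff_cell_and_offCell K).2 (h hM)⟩

variable {K}

/-- THE BEST HONEST COMPOSITION the idea admits (deliberately NOT named `SectorComplement_of`, NOT a
registered skeleton): the cell stub plus the residual "HC off the cell (given the target)". -/
theorem sectorComplement_of_cell_and_offCell (hcell : CellLefschetzOnly K)
    (hoff : MiddleDegreeStep → OffCellHC K) : SectorComplement :=
  fun hM ↦ (hodgeConjecture_iff_cell_and_offCell K).2 ⟨cellHC_of_cellLefschetzOnly hcell, hoff hM⟩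

/-- The residual cannot be dropped or weakened: the crux and the target give it back. -/
theorem offCellHC_of_sectorComplement (h : SectorComplement) (hM : MiddleDegreeStep) : OffCellHC K :=
  ((hodgeConjecture_iff_cell_and_offCell K).1 (h hM)).2

/-! ## §3 Costume certificate -/

/-- COSTUME, mechanically: modulo the line's own cell stub and the crux hypothesis, the residual stub
is EQUIVALENT to the crux. -/
theorem offCellHC_iff_sectorComplement (hcell : CellLefschetzOnly K) (hM : MiddleDegreeStep) :
    OffCellHC K ↔ SectorComplement :=
  ⟨fun h ↦ sectorComplement_of_cell_and_offCell hcell fun _ ↦ h,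
    fun h ↦ offCellHC_of_sectorComplement h hM⟩

/-- The residual is a fragment of the summit for EVERY cell … -/
theorem offCellHC_of_hodgeConjecture (h : _root_.HodgeConjecture) : OffCellHC K :=
  fun _ _ hX _ ↦ h hX

/-- … antitone in the cell (shrinking the cell only moves the residual closer to the summit) … -/
theorem offCellHC_mono {K K' : ℕ → SchemeOver ℂ → Prop} (hKK' : ∀ n X, K n X → K' n X)
    (h : OffCellHC K) : OffCellHC K' :=
  fun n X hX hK' ↦ h hX fun hK ↦ hK' (hKK' n X hK)

/-- … for every cell inside the compact-ball-quotient family (𝒦 is one: `IsCompactBallQuotient`), the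
residual stub CONTAINS the Hodge conjecture for every smooth projective variety that is not a compact
ball quotient — abelian varieties, hypersurfaces, everything with non-ample canonical bundle. -/
theorem offCellHC_nonBallQuotient (hK : ∀ n X, K n X → IsCompactBallQuotient n X) (h : OffCellHC K)
    {n : ℕ} {X : SchemeOver ℂ} (hX : IsSmoothProjective n X) (hq : ¬ IsCompactBallQuotient n X) :
    HodgeConjectureFor n X :=
  h hX fun hKX ↦ hq (hK n X hKX)

/-- … and for the only instance of 𝒦 constructible in the tree today — the EMPTY cell (no
division-algebra datum D1 exists) — the residual stub is the summit verbatim. -/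
theorem offCellHC_empty_iff : OffCellHC (fun _ _ ↦ False) ↔ _root_.HodgeConjecture :=
  ⟨fun h _ _ hX ↦ h hX not_false, fun h _ _ hX _ ↦ h hX⟩

/-- Dually, on the empty cell the cell stub is vacuous: over an abstract `K` the line's positive stubs
carry no content until D1–D3 land. -/
theorem cellLefschetzOnly_empty : CellLefschetzOnly (fun _ _ ↦ False) :=
  fun _ _ _ h ↦ h.elim

/-! ## §4 The negative format — where the idea meets the crux by name -/

variable (K)

/-- The card's unconditional-on-paper consequence of Tate-freeness of the non-Lefschetz Speh pieces
(Harris–Taylor VI.2.1 + JL/MW + Clifford on HT-regular irreducible `r(μ)`): on the cell, in each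
degree the ALGEBRAIC classes span at most a line (`Algᵏ ⊆ ℂ·Lᵏ`). Untypable inputs hidden: étale cycle
class, Betti–étale comparison, Hecke-isotypic decomposition. -/
def CellAlgebraicRankLeOne : Prop :=
  ∀ ⦃n : ℕ⦄ ⦃X : SchemeOver ℂ⦄, IsSmoothProjective n X → K n X →
    ∀ k, ∃ ℓ : complexBetti X (2 * k), ∀ a ∈ algebraicClasses X k, ∃ t : ℂ, a = t • ℓ

/-- An EXOTIC configuration on the cell: two linearly independent rational Hodge classes in one degree
on one member (e.g. `L²` and a rational `(2,2)`-line in a `μ₃ ⊠ R₂` piece of a division-algebra 5-ball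
quotient). Linear independence is spelled out (`= LinearIndependent ℂ ![c₁, c₂]`). -/
def CellHodgeRankTwo : Prop :=
  ∃ (n : ℕ) (X : SchemeOver ℂ), IsSmoothProjective n X ∧ K n X ∧
    ∃ (k : ℕ) (c₁ : complexBetti X (2 * k)) (c₂ : complexBetti X (2 * k)),
      c₁ ∈ hdgQ n X k ∧ c₂ ∈ hdgQ n X k ∧ ∀ s t : ℂ, s • c₁ + t • c₂ = 0 → s = 0 ∧ t = 0

variable {K}

/-- Rank ≤ 1 of the algebraic classes plus two independent rational Hodge classes refute the formal
Hodge conjecture (the exotic class is PROVABLY non-algebraic — no cycle could repair it). -/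
theorem not_hodgeConjecture_of_exotic (hA : CellAlgebraicRankLeOne K) (h2 : CellHodgeRankTwo K) :
    ¬ _root_.HodgeConjecture := by
  rintro hHC
  obtain ⟨n, X, hX, hK, k, c₁, c₂, hc₁, hc₂, hli⟩ := h2
  obtain ⟨ℓ, hℓ⟩ := hA hX hK k
  obtain ⟨t₁, rfl⟩ := hℓ c₁ ((hHC hX).2 k c₁ hc₁.1 hc₁.2)
  obtain ⟨t₂, rfl⟩ := hℓ _ ((hHC hX).2 k c₂ hc₂.1 hc₂.2)
  -- the relation t₂ • (t₁ • ℓ) + (-t₁) • (t₂ • ℓ) = 0 forces t₂ = 0 and t₁ = 0, so both classes vanish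
  have hrel : t₂ • (t₁ • ℓ) + (-t₁) • (t₂ • ℓ) = 0 := by
    rw [smul_smul, smul_smul, ← add_smul, mul_comm t₂ t₁, neg_mul, add_neg_cancel, zero_smul]
  obtain ⟨ht₂, ht₁⟩ := hli t₂ (-t₁) hrel
  have ht₁' : t₁ = 0 := neg_eq_zero.1 ht₁
  -- now 1 • c₁ + 0 • c₂ = 0 with c₁ = 0 • ℓ = 0: the relation (1, 0) contradicts independence
  have h10 := (hli 1 0 (by simp [ht₁'])).1
  exact one_ne_zero h10

/-- Hence, by name: the target plus an exotic configuration on the (Tate-free) cell REFUTE the crux —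
the disprover's `¬SectorComplement ↔ MiddleDegreeStep ∧ ¬HC` with the `¬HC` witness in Kottwitz format. -/
theorem not_sectorComplement_of_exotic (hM : MiddleDegreeStep) (hA : CellAlgebraicRankLeOne K)
    (h2 : CellHodgeRankTwo K) : ¬ SectorComplement :=
  not_sectorComplement_iff.2 ⟨hM, not_hodgeConjecture_of_exotic hA h2⟩

/-- Conversely an exotic configuration together with HC on the cell is contradictory: on 𝒦 the Hodge
conjecture is EXACTLY "no exotic configuration" given rank ≤ 1 — the card's honest maximum, typed. -/
theorem not_cellHodgeRankTwo_of_cellHC (hA : CellAlgebraicRankLeOne K) (hcell : CellHC K)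
    (hoff : OffCellHC K) : ¬ CellHodgeRankTwo K :=
  fun h2 ↦ not_hodgeConjecture_of_exotic hA h2 ((hodgeConjecture_iff_cell_and_offCell K).2 ⟨hcell, hoff⟩)

/-! ## §5 Numerology of the cell: the residual degree set `S_p` (decidable) -/

/-- The card's `S_p`: the middle degree `p` together with the degrees `(d−1)(p+1)/d + 2j`
(`d ∣ p+1`, `d` odd `≥ 3`, `0 ≤ j < (p+1)/d`) in which an Adams–Johnson member of a single Speh block
`μ_d ⊠ R_b` (`db = p+1`) on `U(p,1)` has DIAGONAL Hodge type. Off this list the lever predicts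
`H^{k,k}(X) = ℂ·Lᵏ` for `X ∈ 𝒦` of dimension `p` (theorem-candidate; Clozel 1993 for `p+1` prime). -/
def residualDegrees (p : ℕ) : List ℕ :=
  p :: ((List.range (p + 2)).filter (fun d ↦ decide (3 ≤ d) && d % 2 == 1 && (p + 1) % d == 0)).foldr
    (fun d acc ↦ (List.range ((p + 1) / d)).map (fun j ↦ (d - 1) * ((p + 1) / d) + 2 * j) ++ acc) []

/-- Even residual degrees (the only ones that can carry `(k,k)`-classes). -/
def evenResidualDegrees (p : ℕ) : List ℕ :=
  (residualDegrees p).filter (fun g ↦ g % 2 == 0)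

/-- `p = 5` (`p+1 = 6 = 3·2`): residual degrees 4 and 6 — the `μ₃ ⊠ R₂` pieces of the card. -/
example : evenResidualDegrees 5 = [4, 6] := by decide

/-- `p = 7` (`p+1 = 8`): NO even residual degree — the lever gives HC in ALL degrees for Kottwitz
7-ball quotients (modulo its printed inputs). -/
example : evenResidualDegrees 7 = [] := by decide

/-- `p = 15` (`p+1 = 16`): likewise none. -/
example : evenResidualDegrees 15 = [] := by decide

/-- `p = 8` (`p+1 = 9`): residual degrees 8 (middle), 6, 8, 10 — i.e. {6, 8, 10}; the card's
"6, 8, 10, 12" in its Numerology bullet is off by one (its own formula gives `j < 3`). -/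
example : evenResidualDegrees 8 = [8, 6, 8, 10, 8] := by decide

/-- `p = 10` (`p+1 = 11` prime): only the middle degree — HC in every degree `≠ 10`. -/
example : evenResidualDegrees 10 = [10, 10] := by decide

/-- `p = 11` (`p+1 = 12 = 3·4`): degrees 8, 10, 12, 14. -/
example : evenResidualDegrees 11 = [8, 10, 12, 14] := by decide

end Summit.HodgeConjecture.HodgeConjecture.Cruxes.SectorComplement.KottwitzRigidity
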